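import Mathlib
import Summits.NavierStokesRegularity.NavierStokesRegularity.Theorems.TypeIQuarterGateScarEnvelopeTypeISatelliteTowerCriticalEnemy
import Summits.NavierStokesRegularity.NavierStokesRegularity.Theorems.TypeIQuarterGateScarEnvelopeTypeIBudgetCompactness
import Summits.NavierStokesRegularity.NavierStokesRegularity.Theorems.TypeIQuarterGateScarEnvelopeTypeISatelliteTowerGalleryCompactness

/-!
# Satellite tower for crux `ScarEnvelopeTypeI` (stmt-NavierStokesRegularity-23843) — Part R8: ATTAINMENT OR ENERGY ESCAPE

Part R8 of nsreg-p3's ROUND-38 artefact (section `Attainment`): `not_regPt_zero_of_isBackwardSingularPoint`,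
`exists_rootObj_of_tendsto` (closure of ROOT objects under limits of classes at bounded energy, tree
compactness, `𝐈 ≤ 4 I`), ★★ `critAttained_of_bddEnergy` ((S∞) from energy tightness of the η-critical objects),
`minSingRateAttained_of_bddEnergy`, ★ `critAttained_or_energyEscape` (the (S∞) dichotomy), `not_scarEnvelopeTypeI_dichotomy`.
DEDUP (gate `name exists`, p651389): the artefact's origin-case helper `eLpNorm_top_eq_top_of_not_regPt` (partR8 l.23–34) is NOT
re-declared; the landed general lemma of the same name in `…SatelliteTowerGalleryCompactness` (ns-sz-p1 g6, p648930) is imported and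
serves both call sites verbatim (the origin case by definitional unfolding of `(0 : ℝ × E3)`).

PROVENANCE: declaration texts VERBATIM from the HOME artefact of the instrument seat nsreg-p3 g27 (cell `pub/ns-regularity-ideate`):
`round-38/CritRate38.lean` (sha16 `30eed4aabab5065a`, a standalone module written against the TREE; memo `round-38/ROUND-38.md`
4eff55037f29b2fe), scored by referee ref3 g27 (`SCORE-p3-ROUND-38-0828.md`); the author cannot write under `Theorems/`
(`perm.theorems-prover-only`); landed by the prover ns-es-p1 g5 as landing hand of record (director-ns DIRECTOR-NS #237 (3)), split into
≤ 400-line modules, `E3` spelled out, the artefact's `#guard_msgs … #print axioms` certificates not landed.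
`--supports stmt-NavierStokesRegularity-23843 --as helper`.

HONEST FRAMING: instrument theorems about HYPOTHETICAL Type-I zoom limits (Albritton–Barker objects of the census of crux
`TypeIQuarterGate.ScarEnvelopeTypeI`, item 23843); the analytic input is the tree's closure engine (compactness
`local_typeI_compactness_twin_inBall`, sharpened to constant 1 in Part S1; Q1 whole-space), P1 rate inheritance, L8 persistence and the
tree's PROVED small-constant Liouville theorem; Parts R/S are order theory on the re-classing and closure lemmas.  NOTHING OPEN IS
PROVED: 23843, (L′) `TypeILiouvilleAB` / (L′₀), the GLOBAL (S∞) = `CritAttained`, (M𝐈₁), (E1⁺), (E2ᵣ), route ExtremalTypeIConstant's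
cruxes, N0 and Navier–Stokes regularity are OPEN; `critRate`, `levelCrit I`, `liouvilleRate` are `sInf`s that are `0` by junk value
when the defining set is empty (every statement using them carries the nonemptiness hypothesis explicitly).
-/

-- the summit-side namespace repeats a component by design (single-conjunct summit, D-0017)
set_option linter.dupNamespace false

open MeasureTheory Set Metric Filter Topology
open scoped ENNReal NNReal InnerProductSpace
open Literature.Analysis.FluidPDE

namespace Summit.NavierStokesRegularity.NavierStokesRegularity.Cruxes.ScarEnvelopeTypeI.ZoomDictionary

section Attainment

/-! ### R8. ATTAINMENT OR ENERGY ESCAPE — closure of root objects under class limits at bounded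
Type-I energy (the tree's sequence compactness `local_typeI_compactness_twin_inBall` + the Q1
representative chain + persistence), hence `CritAttained` ((S∞)) from ENERGY TIGHTNESS of the
η-critical root objects, and the dichotomy. -/

/-- A backward singular point at the origin (essential unboundedness on every `Q_r(0)`,
Albritton–Barker) is not a regular point (essential boundedness on some `Q_r(0)`). -/
theorem not_regPt_zero_of_isBackwardSingularPoint {V : ℝ → (EuclideanSpace ℝ (Fin 3)) → (EuclideanSpace ℝ (Fin 3))}
    (h : IsBackwardSingularPoint V (0 : ℝ × (EuclideanSpace ℝ (Fin 3)))) : ¬ RegPt V 0 := by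
  rintro ⟨r, hr, A, hA⟩
  have hfin : eLpNorm (Function.uncurry V) ⊤
      (volume.restrict (parabolicCylinder r (0 : ℝ × (EuclideanSpace ℝ (Fin 3))))) < ⊤ := by
    rw [eLpNorm_exponent_top]
    refine eLpNormEssSup_lt_top_of_ae_bound (C := A) ?_
    exact hA.mono fun z hz => hz
  exact hfin.ne (h r hr)

/-- ★★ **R8. CLOSURE OF ROOT OBJECTS UNDER CLASS LIMITS AT BOUNDED ENERGY.**  Let `n_k` be root
objects (A–B objects singular at the final-time origin) of classes `M_k → M_∞` whose Type-I energies
`𝐈(n_k)` are bounded by `I < ∞`.  Then there is a root object of class `M_∞` with `𝐈 ≤ 4 I`.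
(Tree compactness `local_typeI_compactness_twin_inBall` with the class on all balls; the a.e. rate
`M_∞/√(−t)` of the limit from a.e.-convergent subsequences; the Q1 representative chain
`exists_repr_hasTypeITimeDecay` → `exists_oseenMild_repr_of_typeIBound_lt_top` → KNSS; the origin
stays singular by the persistence clause of the compactness theorem — every approximant is
essentially unbounded on every `Q_R(0)` — transported to the representative by the census
identification.) -/
theorem exists_rootObj_of_tendsto {Ms : ℕ → ℝ} {Minf : ℝ} {I : ℝ≥0∞} (hI : I < ⊤) (n : ℕ → TNode)
    (hn : ∀ k, RootObj (Ms k) (n k))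
    (hbd : ∀ k, typeIBound (Iio (0 : ℝ) ×ˢ univ) (n k).U (n k).P (n k).H ≤ I)
    (hM : Tendsto Ms atTop (𝓝 Minf)) :
    ∃ n' : TNode, RootObj Minf n' ∧ typeIBound (Iio (0 : ℝ) ×ˢ univ) n'.U n'.P n'.H ≤ 4 * I := by
  have hcc_pos : ∀ m : ℕ, (0 : ℝ) < (2 : ℝ) ^ m := fun m => by positivity
  set v : ℕ → ℝ → (EuclideanSpace ℝ (Fin 3)) → (EuclideanSpace ℝ (Fin 3)) := fun k => (n k).U with hvdef
  set q : ℕ → ℝ → (EuclideanSpace ℝ (Fin 3)) → ℝ := fun k => (n k).P with hqdef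
  set Gz : ℕ → ℝ → (EuclideanSpace ℝ (Fin 3)) → (EuclideanSpace ℝ (Fin 3)) →L[ℝ] (EuclideanSpace ℝ (Fin 3)) := fun k => (n k).H with hGzdef
  have hAB : ∀ k, ABTower (Ms k) (v k) (q k) (Gz k) := fun k => (hn k).1
  have hsing : ∀ k, ¬ RegPt (v k) 0 := fun k => (hn k).2
  have hballs : ∀ m k : ℕ, IsSuitableWeakSolutionInBall ((2 : ℝ) ^ m) (0 : ℝ × (EuclideanSpace ℝ (Fin 3))) (v k) (q k) :=
    fun m k => (hAB k).2.1 _ (hcc_pos m)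
  have hQsl : ∀ ρ : ℝ, (parabolicCylinderOpens ρ (0 : ℝ × (EuclideanSpace ℝ (Fin 3))) : TopologicalSpace.Opens (ℝ × (EuclideanSpace ℝ (Fin 3)))) ≤
      slab (EuclideanSpace ℝ (Fin 3)) (Iio 0) isOpen_Iio := fun ρ w hw => parabolicCylinder_origin_subset_slab ρ hw
  have hgrads : ∀ m k : ℕ,
      HasWeakSpatialGradientOn (parabolicCylinderOpens ((2 : ℝ) ^ m) (0 : ℝ × (EuclideanSpace ℝ (Fin 3)))) (v k) (Gz k) :=
    fun m k => (hAB k).2.2.1.mono (hQsl _)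
  have hIs : ∀ m k : ℕ,
      typeIBound (parabolicCylinder ((2 : ℝ) ^ m) (0 : ℝ × (EuclideanSpace ℝ (Fin 3)))) (v k) (q k) (Gz k) ≤ I :=
    fun m k => (typeIBound_mono (parabolicCylinder_origin_subset_slab _)).trans (hbd k)
  -- ## compactness with the class on all balls (tree)
  obtain ⟨Ut, Pt, Ht, σ, hσ, hIBU, hswU, hHU, h4I, hmemU, hconvU, hpers⟩ :=
    Summit.NavierStokesRegularity.NavierStokesRegularity.Cruxes.ScarEnvelopeTypeI.SliceBudget.local_typeI_compactness_twin_inBall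
      I v q Gz hI (fun m k _ => hballs m k) (fun m k _ => hgrads m k) (fun m k _ => hIs m k)
  -- ## nonnegativity of the classes and of the limit class
  have hMk : ∀ k, 0 ≤ Ms k := fun k => by
    have h := (hAB k).1.2.2.2 (-1) (by norm_num) 0
    rw [neg_neg, Real.sqrt_one, div_one] at h
    exact (norm_nonneg _).trans h
  have hMinf : 0 ≤ Minf := ge_of_tendsto' hM hMk
  -- ## the rate `M_∞/√(−t)` of the limit, a.e.
  have hrate_ae : ∀ᵐ w ∂(volume.restrict (Iio (0 : ℝ) ×ˢ (univ : Set (EuclideanSpace ℝ (Fin 3))))),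
      ‖Ut w.1 w.2‖ ≤ Minf / Real.sqrt (-w.1) := by
    have hQ : ∀ m : ℕ, ∀ᵐ w ∂(volume.restrict (parabolicCylinder ((2 : ℝ) ^ m) (0 : ℝ × (EuclideanSpace ℝ (Fin 3))))),
        ‖Ut w.1 w.2‖ ≤ Minf / Real.sqrt (-w.1) := by
      intro m
      have hmeas : ∀ j, AEStronglyMeasurable (Function.uncurry (v (σ j)))
          (volume.restrict (parabolicCylinder ((2 : ℝ) ^ m) (0 : ℝ × (EuclideanSpace ℝ (Fin 3))))) := fun j =>
        (hballs m (σ j)).1.distributional.1.aestronglyMeasurable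
      obtain ⟨ψ, hψ, hae⟩ := exists_subseq_tendsto_ae₃ hmeas (hmemU _ (hcc_pos m)).1
        (hconvU _ (hcc_pos m))
      filter_upwards [hae, ae_restrict_mem (isOpen_parabolicCylinder _ _).measurableSet]
        with w hw hwmem
      have hw0 : w.1 < 0 := by
        have h1 := ((mem_parabolicCylinder).1 hwmem).1.2
        simpa using h1
      have hlim : Tendsto (fun i => Ms (σ (ψ i)) / Real.sqrt (-w.1)) atTop
          (𝓝 (Minf / Real.sqrt (-w.1))) :=
        ((hM.comp hσ.tendsto_atTop).comp hψ.tendsto_atTop).div_const _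
      exact le_of_tendsto_of_tendsto hw.norm hlim
        (Eventually.of_forall fun i => (hAB (σ (ψ i))).1.2.2.2 _ hw0 _)
    have hcover : (Iio (0 : ℝ) ×ˢ (univ : Set (EuclideanSpace ℝ (Fin 3)))) ⊆
        ⋃ m : ℕ, parabolicCylinder ((2 : ℝ) ^ m) (0 : ℝ × (EuclideanSpace ℝ (Fin 3))) := by
      rintro ⟨t, x⟩ ⟨ht', -⟩
      obtain ⟨m, hm⟩ := exists_mem_parabolicCylinder_two_pow₃ (mem_Iio.1 ht') x
      exact mem_iUnion.2 ⟨m, hm⟩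
    exact ae_restrict_of_ae_restrict_of_subset hcover ((ae_restrict_iUnion_iff _ _).2 hQ)
  -- ## representatives: the rate everywhere, then continuous Oseen-mild (KNSS) — as in Q1
  obtain ⟨U₁, hae₁, hdec₁⟩ := exists_repr_hasTypeITimeDecay hMinf hrate_ae
  have hae₁' : ∀ᵐ w ∂(volume.restrict ((slab (EuclideanSpace ℝ (Fin 3)) (Iio 0) isOpen_Iio :
      TopologicalSpace.Opens (ℝ × (EuclideanSpace ℝ (Fin 3)))) : Set (ℝ × (EuclideanSpace ℝ (Fin 3))))),
      Function.uncurry Ut w = Function.uncurry U₁ w := by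
    rw [coe_slab]
    exact hae₁
  have hsw₁ : IsSuitableWeakSolutionOn (slab (EuclideanSpace ℝ (Fin 3)) (Iio 0) isOpen_Iio) 1 0 U₁ Pt :=
    hswU.congr_ae hae₁' (ae_of_all _ fun _ => rfl)
  have hI₁ : typeIBound (Iio (0 : ℝ) ×ˢ univ) U₁ Pt Ht < ⊤ := by
    rw [← typeIBound_congr_ae hae₁]
    exact lt_of_le_of_lt h4I (ENNReal.mul_lt_top (by simp) hI)
  obtain ⟨U', hae₂, hUc, hUdiv, hUmild, hUrate⟩ :=
    exists_oseenMild_repr_of_typeIBound_lt_top hsw₁ hdec₁ hI₁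
  have hae : ∀ᵐ w ∂(volume.restrict (Iio (0 : ℝ) ×ˢ (univ : Set (EuclideanSpace ℝ (Fin 3))))),
      Function.uncurry Ut w = Function.uncurry U' w := by
    filter_upwards [hae₁, hae₂] with w h1 h2
    rw [h1, h2]
  have hae' : ∀ᵐ w ∂(volume.restrict ((slab (EuclideanSpace ℝ (Fin 3)) (Iio 0) isOpen_Iio :
      TopologicalSpace.Opens (ℝ × (EuclideanSpace ℝ (Fin 3)))) : Set (ℝ × (EuclideanSpace ℝ (Fin 3))))),
      Function.uncurry Ut w = Function.uncurry U' w := by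
    rw [coe_slab]
    exact hae
  have hTI : IsTypeIAncientMild Minf U' :=
    LocalTypeIBlowup.isTypeIAncientMild_of_continuous_oseenMild_rate hUc hUdiv hUmild hUrate
  have hIBU' : ∀ a : ℝ, 0 < a → IsSuitableWeakSolutionInBall a (0 : ℝ × (EuclideanSpace ℝ (Fin 3))) U' Pt := fun a ha =>
    (hIBU a ha).congr_ae'
      (ae_restrict_of_ae_restrict_of_subset (parabolicCylinder_origin_subset_slab a) hae)
      (ae_of_all _ fun _ => rfl)
  have hHU' : HasWeakSpatialGradientOn (slab (EuclideanSpace ℝ (Fin 3)) (Iio 0) isOpen_Iio) U' Ht := hHU.congr_ae hae'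
  have hIU'le : typeIBound (Iio (0 : ℝ) ×ˢ univ) U' Pt Ht ≤ 4 * I := by
    rw [← typeIBound_congr_ae hae]
    exact h4I
  have hIU' : typeIBound (Iio (0 : ℝ) ×ˢ univ) U' Pt Ht < ⊤ :=
    lt_of_le_of_lt hIU'le (ENNReal.mul_lt_top (by simp) hI)
  -- ## the origin stays singular
  have hsingU : IsBackwardSingularPoint Ut (0 : ℝ × (EuclideanSpace ℝ (Fin 3))) := by
    refine hpers 0 (by simp) fun R hR => ?_
    have hc : ∀ j, eLpNorm (Function.uncurry (v (σ j))) ⊤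
        (volume.restrict (parabolicCylinder R (0 : ℝ × (EuclideanSpace ℝ (Fin 3))))) = ⊤ := fun j =>
      eLpNorm_top_eq_top_of_not_regPt (hsing _) hR.1
    simp only [hc, Filter.limsup_const]
  have h0' : ¬ RegPt U' 0 := by
    intro hr
    apply not_regPt_zero_of_isBackwardSingularPoint hsingU
    have haeR : ∀ R ∈ Ioo (0 : ℝ) 1,
        ∀ᵐ z ∂(volume.restrict (parabolicCylinder R (0 : ℝ × (EuclideanSpace ℝ (Fin 3))))), Ut z.1 z.2 = U' z.1 z.2 :=
      fun R _ => (ae_restrict_of_ae_restrict_of_subset (parabolicCylinder_origin_subset_slab R)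
        hae).mono fun w hw => hw
    exact (regPt_iff_of_ae_eq_of_norm_lt_one haeR (by simp)).2 hr
  exact ⟨⟨U', Pt, Ht, 0⟩, ⟨⟨hTI, hIBU', hHU', hIU'⟩, h0'⟩, hIU'le⟩

/-- ★★ **(S∞) FROM ENERGY TIGHTNESS.**  If for every `η > 0` there is an η-critical root object with
Type-I energy `𝐈 ≤ I < ∞` (I independent of η), then the critical class carries a scar:
`CritAttained` — equivalently (R4) the minimal scar rate is ATTAINED in every scar-carrying class. -/
theorem critAttained_of_bddEnergy {I : ℝ≥0∞} (hI : I < ⊤)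
    (h : ∀ η : ℝ, 0 < η → ∃ n : TNode, EtaCritical η n ∧
      typeIBound (Iio (0 : ℝ) ×ˢ univ) n.U n.P n.H ≤ I) : CritAttained := by
  choose n hn using fun k : ℕ => h (1 / ((k : ℝ) + 1)) (by positivity)
  have hM : Tendsto (fun k : ℕ => critRate + 1 / ((k : ℝ) + 1)) atTop (𝓝 critRate) := by
    have h1 := (tendsto_one_div_add_atTop_nhds_zero_nat (𝕜 := ℝ)).const_add critRate
    simpa using h1
  obtain ⟨n', hn', -⟩ :=
    exists_rootObj_of_tendsto hI n (fun k => (hn k).1) (fun k => (hn k).2) hM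
  exact critAttained_iff_exists_rootObj.2 ⟨n', hn'⟩

/-- (S∞) in a given scar-carrying class from energy tightness of the η-critical root objects. -/
theorem minSingRateAttained_of_bddEnergy {M : ℝ} (hne : (singRates M).Nonempty) {I : ℝ≥0∞}
    (hI : I < ⊤)
    (h : ∀ η : ℝ, 0 < η → ∃ n : TNode, EtaCritical η n ∧
      typeIBound (Iio (0 : ℝ) ×ˢ univ) n.U n.P n.H ≤ I) : MinSingRateAttained M :=
  (minSingRateAttained_iff hne).2 (critAttained_of_bddEnergy hI h)

/-- ★ **THE DICHOTOMY «ATTAINMENT OR ENERGY ESCAPE».**  Either the critical class carries a scar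
(a root object of class EXACTLY `M_c`: a minimal singular Type-I A–B flow, automatically `ExactMin`
and `EquiRated`), or for every energy level `I < ∞` there is an `η > 0` such that EVERY η-critical
root object has Type-I energy `𝐈 > I` (the almost-minimal singular objects lose their energy bound:
(M𝐈₁) in its sharpest, class-free form).  Nothing open is proved. -/
theorem critAttained_or_energyEscape :
    CritAttained ∨ ∀ I : ℝ≥0∞, I < ⊤ → ∃ η : ℝ, 0 < η ∧ ∀ n : TNode, EtaCritical η n →
      I < typeIBound (Iio (0 : ℝ) ×ˢ univ) n.U n.P n.H := by
  by_cases hc : CritAttained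
  · exact Or.inl hc
  · refine Or.inr fun I hI => ?_
    by_contra hcon
    push Not at hcon
    exact hc (critAttained_of_bddEnergy hI hcon)

/-- The dichotomy read against 23843: if `ScarEnvelopeTypeI` fails then EITHER a critical root
object exists (class `M_c ∈ [ε_L, M]`, exactly-minimal, equi-rated) OR the η-critical enemies exist
for all `η > 0` but escape every energy level. -/
theorem not_scarEnvelopeTypeI_dichotomy
    (h : ¬ Summit.NavierStokesRegularity.NavierStokesRegularity.Theses.TypeIQuarterGate.ScarEnvelopeTypeI) :
    (∃ n : TNode, RootObj critRate n ∧ ExactMin critRate n) ∨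
      ((∀ η : ℝ, 0 < η → ∃ n : TNode, EtaCritical η n) ∧
        ∀ I : ℝ≥0∞, I < ⊤ → ∃ η : ℝ, 0 < η ∧ ∀ n : TNode, EtaCritical η n →
          I < typeIBound (Iio (0 : ℝ) ×ˢ univ) n.U n.P n.H) := by
  obtain ⟨M, hne, -, hη⟩ := etaCritical_of_not_scarEnvelopeTypeI h
  rcases critAttained_or_energyEscape with hc | hesc
  · obtain ⟨n, hn⟩ := critAttained_iff_exists_rootObj.1 hc
    exact Or.inl ⟨n, hn, hn.exactMin_of_critRate⟩
  · exact Or.inr ⟨hη, hesc⟩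

end Attainment

end Summit.NavierStokesRegularity.NavierStokesRegularity.Cruxes.ScarEnvelopeTypeI.ZoomDictionary
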